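import Summits.AnomalousDissipation.AnomalousDissipation.Theorems.TaylorCertificatesKolmogorovFloorLineAlgebraTools
import Summits.AnomalousDissipation.AnomalousDissipation.Theorems.TaylorCertificatesKolmogorovFloorLineSymmetry

/-!
# LINE-ALGEBRA stub of line `Sketch` (digit-frame-closure), crux stmt-AnomalousDissipation-15122

One theorem `lineAlgebra` (stub `stub_lineAlgebra` of the line skeleton `Cruxes/KolmogorovFloor/Lines/Sketch.lean`)
about the closed-form response sequences of `Theorems/TaylorCertificatesKolmogorovFloorResponseDefs.lean` (§3 there:
`sigmaC rhoC rhoT lamP lamM Lam yC incC PC xC zC qC ReC RxC RnC`, `LineData.E N T D Gp Gm G`), with four conclusions: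

* (A) transversality `a x_m + T_m y_m + c z_m = 0` (needs `D ≠ 0`);
* (B) exactness `Re_m = Rx_m = Rn_m = 0` at every site `|m| ≠ 2J+2`;
* (C) support: `x_m = y_m = z_m = 0` at even `m` and at `|m| > 2J+1`;
* (D) conjugate symmetry under `(a, c, s, v, m) ↦ (−a, −c, −s, conj v, −m)`.

Pure algebra over `ℂ`; no analysis. Notation: `a c s K X2 e2 n2` the fields of `d`; `κ = X2 c e2 / a`.

## Paper proof
(C) is by definition (`Λ` vanishes off the odd window, the defining filters of `P` are empty beyond it). (A) is the
identity `a(cP − a n2 T y) + T y D + c(−aP − c e2 T y) = T y (D − a² n2 − c² e2) = 0`. For (B):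
(B1) `Rx_m = (πa/N_m)[(N_m − 2T_m) y_{m−1} − (N_m + 2T_m) y_{m+1}] − [m=0] vx = (πa/N_m)(Λ_{m−1} − Λ_{m+1}) − [m=0] vx`
by `N_m ∓ 2T_m = E_{m∓1}` and `E_j y_j = Λ_j`; at `m = 0` this is `(πa/K)(λ₋ − λ₊) − vx = (πa/K)σ − vx = 0`, at even
`m ≠ 0, ±(2J+2)` the two `Λ`'s agree, at odd `m` both vanish. (B2) `a·Re + T_m·Rx + c·Rn = 0` from (A) at `m ± 1`,
`T_{m±1} = T_m ± X2`, solenoidality `a ve + s vx + c vn = 0` of the force, Parseval `a²/e2 + s²/X2 + c²/n2 = K` and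
`T_m²/X2 = s²/X2 + N_m − K`. (B3) `c e2·Re − a n2·Rn = −πa (P_{m+1} − P_{m−1} − inc_m)` from `c e2 x − a n2 z = P`.
(B4) the chain identity `P_{m+1} − P_{m−1} = inc_m` for `|m| ≠ 2J+2`: at odd `m` both sides vanish; at even `m ≥ 2`
the two defining filters `{m+1 < 2i}` and `{m−1 < 2i}` of `range (J+2)` differ exactly by the site `2i = m` when
`m ≤ 2J` and agree when `m ≥ 2J+4` (where `inc_m = 0`); even `m ≤ −2` is symmetric; at `m = 0` it is the CLOSURE
`Σ_{i≤J} inc_{2i+2} + Σ_{i≤J} inc_{−(2i+2)} + inc_0 = 0`, which follows from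
`Σ_{i≤J} y_{2i+1} = λ₊G₊`, `Σ_{i≤J} y_{2i+3} = λ₊G₊ − y_1` (the stray `y_{2J+3}` vanishes), the mirror identities with
`λ₋G₋`, `λ₊G₊ + λ₋G₋ = ρ̃` and `2κρ̃ = ρ`. (B5) With `Rx = 0`, (B2) and (B3)+(B4) read `a·Re + c·Rn = 0`,
`c e2·Re − a n2·Rn = 0`, determinant `D ≠ 0`, so `Re = Rn = 0`.
(D) termwise: `E'_j = E_{−j}`, `T'_j = −T_{−j}`, `D' = D`, `G'_± = G_∓`, `σ' = −conj σ`, `ρ' = conj ρ`, `ρ̃' = conj ρ̃`,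
`λ'_± = conj λ_∓`, `Λ'_m = conj Λ_{−m}`, `inc'_m = conj inc_{−m}`, `P'_m = −conj P_{−m}` (the filters of `P` are
reflection-symmetric), hence the claim for `x, y, z`.

## Structure of the formalisation
(C), (A), (B1)–(B3) are `…LineAlgebraTools.lean`; (D) is `…LineSymmetry.lean`; this file proves (B4)
(`LineAlgebra.chain`, with the closure `LineAlgebra.closure_sum`), concludes (B5) (`LineAlgebra.exact_off_edges`) and
assembles `lineAlgebra`. Helper lemmas live in the sub-namespace `…KolmogorovFloor.Response.LineAlgebra`.
Numerics: the lead's literal python mirror of the definitions (`num/defs_mirror.py`) confirms all four conclusions to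
rounding.
-/

noncomputable section

set_option linter.dupNamespace false -- the problem path repeats `AnomalousDissipation` (forced namespace)

open Finset
open scoped BigOperators ComplexConjugate

namespace Summit.AnomalousDissipation.AnomalousDissipation.Theorems.KolmogorovFloor.Response

namespace LineAlgebra

variable (d : LineData) (F : LineForce) (J : ℕ)

/-! ## The increments -/

/-- `inc_m = κ (y_{m−1} + y_{m+1})` at `m ≠ 0`, `κ = X2 c e2 / a`. -/
theorem incC_of_ne_zero {m : ℤ} (h : m ≠ 0) :
    incC d F J m = (d.X2 : ℂ) * (d.c : ℂ) * (d.e2 : ℂ) / (d.a : ℂ) * (yC d F J (m - 1) + yC d F J (m + 1)) := by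
  unfold incC; rw [if_neg h, sub_zero]

/-- `inc_0 = κ (y_{−1} + y_1) − ρ`. -/
theorem incC_zero :
    incC d F J 0 = (d.X2 : ℂ) * (d.c : ℂ) * (d.e2 : ℂ) / (d.a : ℂ) * (yC d F J (-1) + yC d F J 1) - rhoC d F := by
  unfold incC; rw [if_pos rfl, zero_sub, zero_add]

/-! ## The chain identity off the edge sites, `m ≠ 0` -/

/-- At odd `m` both sides of the chain identity vanish. -/
theorem chain_odd {m : ℤ} (h2 : m % 2 = 1) : PC d F J (m + 1) - PC d F J (m - 1) = incC d F J m := by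
  rw [PC_eq_zero d F J (Or.inl (by omega)), PC_eq_zero d F J (Or.inl (by omega)),
    incC_of_ne_zero d F J (by omega : m ≠ 0), yC_eq_zero d F J (Or.inl (by omega)),
    yC_eq_zero d F J (Or.inl (by omega))]
  ring

/-- The chain identity at even `m ≥ 2`, `m ≠ 2J+2`: the two defining filters differ by the single site `2i = m`
when `m ≤ 2J`, and agree (with `inc_m = 0`) when `m ≥ 2J+4`. -/
theorem chain_pos {m : ℤ} (h2 : m % 2 = 0) (hm : 2 ≤ m) (hJ : m ≠ 2 * (J : ℤ) + 2) :
    PC d F J (m + 1) - PC d F J (m - 1) = incC d F J m := by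
  have e1 : PC d F J (m + 1)
      = -∑ i ∈ range (J + 2), if m + 1 < 2 * (i : ℤ) then incC d F J (2 * (i : ℤ)) else 0 := by
    unfold PC; rw [if_neg (by omega), if_pos (by omega), Finset.sum_filter]
  have e2 : PC d F J (m - 1)
      = -∑ i ∈ range (J + 2), if m - 1 < 2 * (i : ℤ) then incC d F J (2 * (i : ℤ)) else 0 := by
    unfold PC; rw [if_neg (by omega), if_pos (by omega), Finset.sum_filter]
  rw [e1, e2, neg_sub_neg, ← Finset.sum_sub_distrib]
  rcases lt_or_gt_of_ne hJ with hlt | hgt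
  · obtain ⟨i₀, hi₀, rfl⟩ : ∃ i₀ : ℕ, i₀ < J + 2 ∧ m = 2 * (i₀ : ℤ) := ⟨m.toNat / 2, by omega, by omega⟩
    rw [Finset.sum_eq_single i₀]
    · rw [if_pos (by omega), if_neg (by omega), sub_zero]
    · intro i _ hi
      rcases lt_or_gt_of_ne hi with h | h
      · rw [if_neg (by omega), if_neg (by omega), sub_zero]
      · rw [if_pos (by omega), if_pos (by omega), sub_self]
    · intro h; exact absurd (Finset.mem_range.mpr hi₀) h
  · rw [Finset.sum_eq_zero]
    · rw [incC_of_ne_zero d F J (by omega : m ≠ 0), yC_eq_zero d F J (Or.inr _),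
        yC_eq_zero d F J (Or.inr _)]
      · ring
      · simp only [Int.abs_eq_natAbs]; omega
      · simp only [Int.abs_eq_natAbs]; omega
    · intro i hi
      rw [Finset.mem_range] at hi
      rw [if_neg (by omega), if_neg (by omega), sub_zero]

/-- The chain identity at even `m ≤ −2`, `m ≠ −(2J+2)`. -/
theorem chain_neg {m : ℤ} (h2 : m % 2 = 0) (hm : m ≤ -2) (hJ : m ≠ -(2 * (J : ℤ) + 2)) :
    PC d F J (m + 1) - PC d F J (m - 1) = incC d F J m := by
  have e1 : PC d F J (m + 1)
      = ∑ i ∈ range (J + 2), if -(m + 1) < 2 * (i : ℤ) then incC d F J (-(2 * (i : ℤ))) else 0 := by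
    unfold PC; rw [if_neg (by omega), if_neg (by omega), Finset.sum_filter]
  have e2 : PC d F J (m - 1)
      = ∑ i ∈ range (J + 2), if -(m - 1) < 2 * (i : ℤ) then incC d F J (-(2 * (i : ℤ))) else 0 := by
    unfold PC; rw [if_neg (by omega), if_neg (by omega), Finset.sum_filter]
  rw [e1, e2, ← Finset.sum_sub_distrib]
  rcases lt_or_gt_of_ne hJ with hlt | hgt
  · rw [Finset.sum_eq_zero]
    · rw [incC_of_ne_zero d F J (by omega : m ≠ 0), yC_eq_zero d F J (Or.inr _),
        yC_eq_zero d F J (Or.inr _)]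
      · ring
      · simp only [Int.abs_eq_natAbs]; omega
      · simp only [Int.abs_eq_natAbs]; omega
    · intro i hi
      rw [Finset.mem_range] at hi
      rw [if_neg (by omega), if_neg (by omega), sub_zero]
  · obtain ⟨i₀, hi₀, rfl⟩ : ∃ i₀ : ℕ, i₀ < J + 2 ∧ m = -(2 * (i₀ : ℤ)) :=
      ⟨(-m).toNat / 2, by omega, by omega⟩
    rw [Finset.sum_eq_single i₀]
    · rw [if_pos (by omega), if_neg (by omega), sub_zero]
    · intro i _ hi
      rcases lt_or_gt_of_ne hi with h | h
      · rw [if_neg (by omega), if_neg (by omega), sub_zero]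
      · rw [if_pos (by omega), if_pos (by omega), sub_self]
    · intro h; exact absurd (Finset.mem_range.mpr hi₀) h

/-! ## The closure at `m = 0` -/

/-- `Σ_{i ≤ J} y_{2i+1} = λ₊ G₊`. -/
theorem sum_yC_pos : ∑ i ∈ range (J + 1), yC d F J (2 * (i : ℤ) + 1) = lamP d F J * (d.Gp J : ℂ) := by
  unfold LineData.Gp
  rw [Complex.ofReal_sum, Finset.mul_sum]
  refine Finset.sum_congr rfl (fun i hi => ?_)
  rw [Finset.mem_range] at hi
  unfold yC Lam
  rw [if_neg (by simp only [Int.abs_eq_natAbs]; omega), if_pos (by omega)]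
  push_cast
  ring

/-- `Σ_{i ≤ J} y_{−(2i+1)} = λ₋ G₋`. -/
theorem sum_yC_neg : ∑ i ∈ range (J + 1), yC d F J (-(2 * (i : ℤ) + 1)) = lamM d F J * (d.Gm J : ℂ) := by
  unfold LineData.Gm
  rw [Complex.ofReal_sum, Finset.mul_sum]
  refine Finset.sum_congr rfl (fun i hi => ?_)
  rw [Finset.mem_range] at hi
  unfold yC Lam
  rw [if_neg (by simp only [Int.abs_eq_natAbs]; omega), if_neg (by omega)]
  push_cast
  ring

/-- `Σ_{i ≤ J} y_{2i+3} = λ₊ G₊ − y_1` (the stray term `y_{2J+3}` vanishes). -/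
theorem sum_yC_pos_shift :
    ∑ i ∈ range (J + 1), yC d F J (2 * (i : ℤ) + 2 + 1) = lamP d F J * (d.Gp J : ℂ) - yC d F J 1 := by
  have h := Finset.sum_range_succ' (fun i : ℕ => yC d F J (2 * (i : ℤ) + 1)) (J + 1)
  rw [Finset.sum_range_succ, sum_yC_pos, yC_eq_zero d F J (Or.inr _)] at h
  · push_cast at h
    rw [eq_sub_iff_add_eq]
    convert h.symm using 3 with i
    · ring_nf
    · ring_nf
  · push_cast; simp only [Int.abs_eq_natAbs]; omega

/-- `Σ_{i ≤ J} y_{−(2i+2)−1} = λ₋ G₋ − y_{−1}` (the stray term `y_{−(2J+3)}` vanishes). -/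
theorem sum_yC_neg_shift :
    ∑ i ∈ range (J + 1), yC d F J (-(2 * (i : ℤ) + 2) - 1) = lamM d F J * (d.Gm J : ℂ) - yC d F J (-1) := by
  have h := Finset.sum_range_succ' (fun i : ℕ => yC d F J (-(2 * (i : ℤ) + 1))) (J + 1)
  rw [Finset.sum_range_succ, sum_yC_neg, yC_eq_zero d F J (Or.inr _)] at h
  · push_cast at h
    rw [eq_sub_iff_add_eq]
    convert h.symm using 3 with i
    · ring_nf
    · ring_nf
  · push_cast; simp only [Int.abs_eq_natAbs]; omega

/-- `λ₊ G₊ + λ₋ G₋ = ρ̃` (`G ≠ 0`). -/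
theorem lam_G (hG : d.G J ≠ 0) : lamP d F J * (d.Gp J : ℂ) + lamM d F J * (d.Gm J : ℂ) = rhoT d F := by
  have hG' : ((d.G J : ℝ) : ℂ) ≠ 0 := Complex.ofReal_ne_zero.mpr hG
  unfold lamP lamM
  rw [div_mul_eq_mul_div, div_mul_eq_mul_div, ← add_div, div_eq_iff hG']
  simp only [LineData.G, Complex.ofReal_add]
  ring

/-- **The closure**: the increments over the even sites of `[−2J−2, 2J+2]` sum to zero. -/
theorem closure_sum (ha : d.a ≠ 0) (hc : d.c ≠ 0) (hX : d.X2 ≠ 0) (he : d.e2 ≠ 0) (hG : d.G J ≠ 0) :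
    ∑ i ∈ range (J + 1), incC d F J (2 * (i : ℤ) + 2)
      + ∑ i ∈ range (J + 1), incC d F J (-(2 * (i : ℤ) + 2)) + incC d F J 0 = 0 := by
  have s1 : ∑ i ∈ range (J + 1), incC d F J (2 * (i : ℤ) + 2)
      = (d.X2 : ℂ) * (d.c : ℂ) * (d.e2 : ℂ) / (d.a : ℂ)
        * (lamP d F J * (d.Gp J : ℂ) + (lamP d F J * (d.Gp J : ℂ) - yC d F J 1)) := by
    rw [← sum_yC_pos_shift, ← sum_yC_pos, ← Finset.sum_add_distrib, Finset.mul_sum]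
    refine Finset.sum_congr rfl (fun i _ => ?_)
    rw [incC_of_ne_zero d F J (by omega : (2 * (i : ℤ) + 2) ≠ 0),
      show (2 * (i : ℤ) + 2 - 1) = 2 * (i : ℤ) + 1 by ring]
  have s2 : ∑ i ∈ range (J + 1), incC d F J (-(2 * (i : ℤ) + 2))
      = (d.X2 : ℂ) * (d.c : ℂ) * (d.e2 : ℂ) / (d.a : ℂ)
        * ((lamM d F J * (d.Gm J : ℂ) - yC d F J (-1)) + lamM d F J * (d.Gm J : ℂ)) := by
    rw [← sum_yC_neg_shift, ← sum_yC_neg, ← Finset.sum_add_distrib, Finset.mul_sum]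
    refine Finset.sum_congr rfl (fun i _ => ?_)
    rw [incC_of_ne_zero d F J (by omega : (-(2 * (i : ℤ) + 2)) ≠ 0),
      show (-(2 * (i : ℤ) + 2) + 1) = -(2 * (i : ℤ) + 1) by ring]
  have key := lam_G d F J hG
  have ha' : (d.a : ℂ) ≠ 0 := by exact_mod_cast ha
  have hc' : (d.c : ℂ) ≠ 0 := by exact_mod_cast hc
  have hX' : (d.X2 : ℂ) ≠ 0 := by exact_mod_cast hX
  have he' : (d.e2 : ℂ) ≠ 0 := by exact_mod_cast he
  have hρ : 2 * ((d.X2 : ℂ) * (d.c : ℂ) * (d.e2 : ℂ) / (d.a : ℂ)) * rhoT d F = rhoC d F := by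
    unfold rhoT
    field_simp
  rw [s1, s2, incC_zero]
  linear_combination 2 * ((d.X2 : ℂ) * (d.c : ℂ) * (d.e2 : ℂ) / (d.a : ℂ)) * key + hρ

/-- The chain identity at `m = 0` is the closure. -/
theorem chain_zero (ha : d.a ≠ 0) (hc : d.c ≠ 0) (hX : d.X2 ≠ 0) (he : d.e2 ≠ 0) (hG : d.G J ≠ 0) :
    PC d F J (0 + 1) - PC d F J (0 - 1) = incC d F J 0 := by
  have hf : (range (J + 2)).filter (fun i : ℕ => (1 : ℤ) < 2 * (i : ℤ)) = Finset.Ico 1 (J + 2) := by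
    ext i; simp only [Finset.mem_filter, Finset.mem_range, Finset.mem_Ico]; omega
  have hr : range (J + 2 - 1) = range (J + 1) := by norm_num
  have e1 : PC d F J 1 = -∑ i ∈ range (J + 1), incC d F J (2 * (i : ℤ) + 2) := by
    unfold PC
    rw [if_neg (by omega), if_pos one_pos, hf, Finset.sum_Ico_eq_sum_range]
    congr 1
    refine Finset.sum_congr hr (fun i _ => ?_)
    congr 1
    push_cast
    ring
  have e2 : PC d F J (-1) = ∑ i ∈ range (J + 1), incC d F J (-(2 * (i : ℤ) + 2)) := by
    unfold PC
    rw [if_neg (by omega), if_neg (by omega), neg_neg, hf, Finset.sum_Ico_eq_sum_range]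
    refine Finset.sum_congr hr (fun i _ => ?_)
    congr 1
    push_cast
    ring
  rw [zero_add, zero_sub, e1, e2]
  linear_combination -(closure_sum d F J ha hc hX he hG)

/-- **The chain identity** `P_{m+1} − P_{m−1} = inc_m` at every site `|m| ≠ 2J+2`. -/
theorem chain (ha : d.a ≠ 0) (hc : d.c ≠ 0) (hX : d.X2 ≠ 0) (he : d.e2 ≠ 0) (hG : d.G J ≠ 0) {m : ℤ}
    (hm : |m| ≠ 2 * (J : ℤ) + 2) : PC d F J (m + 1) - PC d F J (m - 1) = incC d F J m := by
  simp only [Int.abs_eq_natAbs] at hm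
  by_cases h2 : m % 2 = 0
  · rcases lt_trichotomy m 0 with hlt | rfl | hgt
    · exact chain_neg d F J h2 (by omega) (by omega)
    · exact chain_zero d F J ha hc hX he hG
    · exact chain_pos d F J h2 (by omega) (by omega)
  · exact chain_odd d F J (by omega)

/-- **Exactness off the edge sites**: `Re_m = Rx_m = Rn_m = 0` for `|m| ≠ 2J+2`. -/
theorem exact_off_edges (ha : d.a ≠ 0) (hc : d.c ≠ 0) (hX : d.X2 ≠ 0) (he : d.e2 ≠ 0) (hn : d.n2 ≠ 0)
    (hD : d.D ≠ 0) (hG : d.G J ≠ 0) (hE : ∀ m : ℤ, m % 2 = 1 → d.E m ≠ 0) (hN : ∀ m : ℤ, d.N m ≠ 0)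
    (hdiv : (d.a : ℂ) * F.ve + (d.s : ℂ) * F.vx + (d.c : ℂ) * F.vn = 0)
    (hP : (d.a : ℂ) ^ 2 / (d.e2 : ℂ) + (d.s : ℂ) ^ 2 / (d.X2 : ℂ) + (d.c : ℂ) ^ 2 / (d.n2 : ℂ) = (d.K : ℂ))
    {m : ℤ} (hm : |m| ≠ 2 * (J : ℤ) + 2) : ReC d F J m = 0 ∧ RxC d F J m = 0 ∧ RnC d F J m = 0 := by
  have hx : RxC d F J m = 0 := RxC_eq_zero d F J ha hX hG hE hN hm
  have h1 := combo_k d F J hX hD hN hdiv hP m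
  rw [hx, mul_zero, add_zero] at h1
  have h2 := combo_w d F J ha he hn hD m
  rw [chain d F J ha hc hX he hG hm, sub_self, mul_zero] at h2
  have hD' : (d.D : ℂ) ≠ 0 := by exact_mod_cast hD
  have hRe : (d.D : ℂ) * ReC d F J m = 0 := by
    rw [D_cast]
    linear_combination ((d.a : ℂ) * (d.n2 : ℂ)) * h1 + (d.c : ℂ) * h2
  have hRn : (d.D : ℂ) * RnC d F J m = 0 := by
    rw [D_cast]
    linear_combination ((d.c : ℂ) * (d.e2 : ℂ)) * h1 - (d.a : ℂ) * h2
  exact ⟨(mul_eq_zero.mp hRe).resolve_left hD', hx, (mul_eq_zero.mp hRn).resolve_left hD'⟩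

end LineAlgebra

open LineAlgebra in
/-- **LINE-ALGEBRA.** The closed-form response sequences on a mode line are solenoidal, solve the linearised steady
Euler equations exactly at every site `m ≠ ±(2J+2)`, are supported on the odd window, and are conjugate-symmetric
under `(a, c, s, v, m) ↦ (−a, −c, −s, conj v, −m)`. -/
theorem lineAlgebra : ∀ (d : LineData) (F : LineForce) (J : ℕ),
    d.a ≠ 0 → d.c ≠ 0 → d.X2 ≠ 0 → d.e2 ≠ 0 → d.n2 ≠ 0 → d.D ≠ 0 → d.G J ≠ 0 →
    (∀ m : ℤ, m % 2 = 1 → d.E m ≠ 0) → (∀ m : ℤ, d.N m ≠ 0) →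
    (d.a : ℂ) * F.ve + (d.s : ℂ) * F.vx + (d.c : ℂ) * F.vn = 0 →
    (d.a : ℂ) ^ 2 / (d.e2 : ℂ) + (d.s : ℂ) ^ 2 / (d.X2 : ℂ) + (d.c : ℂ) ^ 2 / (d.n2 : ℂ) = (d.K : ℂ) →
    (∀ m : ℤ, (d.a : ℂ) * xC d F J m + (d.T m : ℂ) * yC d F J m + (d.c : ℂ) * zC d F J m = 0) ∧
    (∀ m : ℤ, |m| ≠ 2 * (J : ℤ) + 2 → ReC d F J m = 0 ∧ RxC d F J m = 0 ∧ RnC d F J m = 0) ∧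
    (∀ m : ℤ, (m % 2 = 0 ∨ 2 * (J : ℤ) + 1 < |m|) → xC d F J m = 0 ∧ yC d F J m = 0 ∧ zC d F J m = 0) ∧
    (∀ m : ℤ, let d' : LineData := ⟨-d.a, -d.c, -d.s, d.K, d.X2, d.e2, d.n2⟩
      let F' : LineForce := ⟨starRingEnd ℂ F.ve, starRingEnd ℂ F.vx, starRingEnd ℂ F.vn⟩
      xC d' F' J m = starRingEnd ℂ (xC d F J (-m)) ∧ yC d' F' J m = starRingEnd ℂ (yC d F J (-m)) ∧
      zC d' F' J m = starRingEnd ℂ (zC d F J (-m))) := by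
  intro d F J ha hc hX he hn hD hG hE hN hdiv hP
  refine ⟨fun m => transversal d F J hD m,
    fun m hm => exact_off_edges d F J ha hc hX he hn hD hG hE hN hdiv hP hm,
    fun m h => ⟨xC_eq_zero d F J h, yC_eq_zero d F J h, zC_eq_zero d F J h⟩, ?_⟩
  intro m d' F'
  exact ⟨refl_xC d d' F F' J rfl rfl m, refl_yC d d' F F' J rfl rfl m, refl_zC d d' F F' J rfl rfl m⟩

end Summit.AnomalousDissipation.AnomalousDissipation.Theorems.KolmogorovFloor.Response
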